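import Summits.CriticalPhenomena.PercolationContinuityZ3.Theorems.PercNearOneGluingNoHeavyLowerTailTwoCutMaster
import Summits.CriticalPhenomena.PercolationContinuityZ3.Theorems.PercNearOneGluingNoHeavyLowerTailLonelyRelay
import HarnessLib

/-!
# `NoHeavyLowerTail` (stmt-CriticalPhenomena-4575) — three-relay EVENT GLUING with constant `4/3`

Support file (depth prover nh-dp-blobmono gen 2; `--supports stmt-CriticalPhenomena-4575`).  No definitions, no named
facts, no sorries.

The event form of Kozma–Nitzan's additive gluing for three relays,
`EG₃ : μ({o ↮ d} ∩ ({o ↔ a} ∪ {o ↔ b} ∪ {o ↔ c})) ≤ max_x μ{x ↮ d}`,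
is open (it is the k = 3 case of the event gluing contained in the CIL engine, `…CILEventGluing`; no Positivstellensatz
certificate of degree ≤ 3 from the BHK/KN calculus exists, REPORT-gen2 of this unit).  The union bound gives the constant
`3`, C⁺ (`Theorems.lonelyOrPair_le`) the constant `2`.  THIS FILE proves the constant `4/3` by averaging C⁺ over the three
pairs and paying the three "lonely third relay" events at once with the lonely relay lemma (KN Lemma 2) for `A = {a,b,c,d}`:
for each relay `z`, `E ⊆ ({o ↮ d} ∩ ({o ↔ x} ∪ {o ↔ y})) ∪ S_z` with `S_z = {o ↔ z only among a,b,c,d}`, so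
`3 μ(E) ≤ 3t + Σ_z μ(S_z) ≤ 3t + μ{N_{abcd} = 1} ≤ 4t`.

* `eventGluing_three_le_fourThirds` — `μ(E) ≤ 4/3 · t` if `μ{x ↮ d} ≤ t` for `x = a, b, c` (pairwise distinct `a,b,c,d`);
* `additiveGluing_three_fourThirds` — the additive form `μ(o ↔ {a,b,c}) − 4/3 · t ≤ μ(o ↔ d)`.
(The degree-3 certificate machine reaches the constant `5/4` numerically, kit j037378; the conjectured constant is `1`.)
-/

noncomputable section

namespace Summit.CriticalPhenomena.PercolationContinuityZ3.Theorems

open MeasureTheory Set Literature.Probability.LatticeModels Literature.Probability.Percolation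
open scoped Classical BigOperators

variable {n : ℕ}

/-- **Three-relay event gluing with constant `4/3`.**  For pairwise distinct `a, b, c, d` and any `o`: if
`μ{a ↮ d}, μ{b ↮ d}, μ{c ↮ d} ≤ t` then `μ({o ↮ d} ∩ ({o ↔ a} ∪ {o ↔ b} ∪ {o ↔ c})) ≤ 4/3 · t`.
[cite: KozmaNitzan2024, Lemma 2 (p. 6); VandenbergHaggstromKahn2005, Thm. 1.5] -/
theorem eventGluing_three_le_fourThirds (w : Sym2 (Fin n) → unitInterval) (o a b c d : Fin n) (t : ℝ)
    (hab : a ≠ b) (hac : a ≠ c) (had : a ≠ d) (hbc : b ≠ c) (hbd : b ≠ d) (hcd : c ≠ d)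
    (ha : (prodBernoulli w).real (openConn a d : Set (BondConfig (Fin n)))ᶜ ≤ t)
    (hb : (prodBernoulli w).real (openConn b d : Set (BondConfig (Fin n)))ᶜ ≤ t)
    (hc : (prodBernoulli w).real (openConn c d : Set (BondConfig (Fin n)))ᶜ ≤ t) :
    (prodBernoulli w).real ((openConn o d : Set (BondConfig (Fin n)))ᶜ ∩
        (openConn o a ∪ openConn o b ∪ openConn o c)) ≤ 4 / 3 * t := by
  set μ := prodBernoulli w with hμ
  have ht : 0 ≤ t := le_trans measureReal_nonneg ha
  set E : Set (BondConfig (Fin n)) := (openConn o d : Set (BondConfig (Fin n)))ᶜ ∩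
    (openConn o a ∪ openConn o b ∪ openConn o c) with hE
  -- the "lonely third relay" events
  set S : Fin n → Set (BondConfig (Fin n)) := fun z =>
    {ω | ω ∈ (openConn o z : Set (BondConfig (Fin n))) ∧
      ∀ y ∈ ({a, b, c, d} : Finset (Fin n)), y ≠ z → ω ∉ (openConn o y : Set (BondConfig (Fin n)))} with hS
  -- Step 1: for each relay `z`, `E ⊆ (pair event of the other two) ∪ S z`
  have cover : ∀ (x y z : Fin n), ({x, y, z} : Finset (Fin n)) = {a, b, c} →
      E ⊆ ((openConn o d : Set (BondConfig (Fin n)))ᶜ ∩ (openConn o x ∪ openConn o y)) ∪ S z := by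
    intro x y z hxyz ω hω
    obtain ⟨hod, hU⟩ := hω
    by_cases hx : ω ∈ (openConn o x : Set (BondConfig (Fin n)))
    · exact Or.inl ⟨hod, Or.inl hx⟩
    by_cases hy : ω ∈ (openConn o y : Set (BondConfig (Fin n)))
    · exact Or.inl ⟨hod, Or.inr hy⟩
    right
    -- `o` is joined to one of `a,b,c`, hence (not being joined to `x,y`) to `z`
    have hmem : ∀ u ∈ ({a, b, c} : Finset (Fin n)), ω ∈ (openConn o u : Set (BondConfig (Fin n))) → u = z := by
      intro u hu hou
      rw [← hxyz] at hu
      simp only [Finset.mem_insert, Finset.mem_singleton] at hu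
      rcases hu with rfl | rfl | rfl
      · exact absurd hou hx
      · exact absurd hou hy
      · rfl
    have hoz : ω ∈ (openConn o z : Set (BondConfig (Fin n))) := by
      rcases hU with (h | h) | h
      · exact (hmem a (by simp) h) ▸ h
      · exact (hmem b (by simp) h) ▸ h
      · exact (hmem c (by simp) h) ▸ h
    refine ⟨hoz, fun y hy hyz hoy => ?_⟩
    simp only [Finset.mem_insert, Finset.mem_singleton] at hy
    rcases hy with rfl | rfl | rfl | rfl
    · exact hyz (hmem _ (by simp) hoy)
    · exact hyz (hmem _ (by simp) hoy)
    · exact hyz (hmem _ (by simp) hoy)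
    · exact hod hoy
  -- Step 2: each pair event has probability ≤ t (C⁺: lonelyOrPair)
  have pair : ∀ x y : Fin n, μ.real (openConn x d : Set (BondConfig (Fin n)))ᶜ ≤ t →
      μ.real (openConn y d : Set (BondConfig (Fin n)))ᶜ ≤ t →
      μ.real ((openConn o d : Set (BondConfig (Fin n)))ᶜ ∩ (openConn o x ∪ openConn o y)) ≤ t :=
    fun x y hx hy => lonelyOrPair_le w o x y d t hx hy
  have bound : ∀ (x y z : Fin n), ({x, y, z} : Finset (Fin n)) = {a, b, c} →
      μ.real (openConn x d : Set (BondConfig (Fin n)))ᶜ ≤ t → μ.real (openConn y d : Set (BondConfig (Fin n)))ᶜ ≤ t →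
      μ.real E ≤ t + μ.real (S z) := by
    intro x y z hxyz hx hy
    calc μ.real E ≤ μ.real (((openConn o d : Set (BondConfig (Fin n)))ᶜ ∩ (openConn o x ∪ openConn o y)) ∪ S z) :=
          measureReal_mono (cover x y z hxyz)
      _ ≤ μ.real ((openConn o d : Set (BondConfig (Fin n)))ᶜ ∩ (openConn o x ∪ openConn o y)) + μ.real (S z) :=
          measureReal_union_le _ _
      _ ≤ t + μ.real (S z) := by linarith [pair x y hx hy]
  have h1 := bound b c a (by ext u; simp only [Finset.mem_insert, Finset.mem_singleton]; tauto) hb hc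
  have h2 := bound a c b (by ext u; simp only [Finset.mem_insert, Finset.mem_singleton]; tauto) ha hc
  have h3 := bound a b c rfl ha hb
  -- Step 3: the three lonely events are disjoint pieces of `{N_{abcd} = 1}`, which has probability ≤ t
  set A : Finset (Fin n) := {a, b, c, d} with hA
  set N1 : Set (BondConfig (Fin n)) := {ω : Set (Sym2 (Fin n)) | (A.filter fun y => ω ∈ openConn o y).card = 1} with hN1
  have hSN : ∀ z ∈ A, S z ⊆ N1 := by
    intro z hz ω hω
    obtain ⟨hoz, hother⟩ := hω
    show (A.filter fun y => ω ∈ openConn o y).card = 1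
    rw [Finset.card_eq_one]
    refine ⟨z, Finset.ext fun y => ⟨fun hy => ?_, fun hy => ?_⟩⟩
    · obtain ⟨hyA, hoy⟩ := Finset.mem_filter.1 hy
      rw [Finset.mem_singleton]
      by_contra hyz
      exact hother y hyA hyz hoy
    · rw [Finset.mem_singleton] at hy
      subst hy
      exact Finset.mem_filter.2 ⟨hz, hoz⟩
  have iso_le : ∀ x ∈ A, ∀ y ∈ A, y ≠ x → μ.real (openConn x y : Set (BondConfig (Fin n)))ᶜ ≤ t →
      μ.real {ω | ∀ t' ∈ A.erase x, ω ∉ openConn x t'} ≤ t :=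
    fun x _ y hy hyx hle =>
      le_trans (measureReal_mono fun ω hω hxy => hω y (Finset.mem_erase.2 ⟨hyx, hy⟩) hxy) hle
  have hda : μ.real (openConn d a : Set (BondConfig (Fin n)))ᶜ ≤ t := by
    have : (openConn d a : Set (BondConfig (Fin n))) = openConn a d := by
      ext ω; exact SimpleGraph.reachable_comm
    rw [this]; exact ha
  have hN1t : μ.real N1 ≤ t := by
    refine lonelyRelay n w A o t ht fun x hx => ?_
    have hx' : x = a ∨ x = b ∨ x = c ∨ x = d := by simpa [hA] using hx
    rcases hx' with h | h | h | h <;> rw [h]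
    · exact iso_le a (by simp [hA]) d (by simp [hA]) had.symm ha
    · exact iso_le b (by simp [hA]) d (by simp [hA]) hbd.symm hb
    · exact iso_le c (by simp [hA]) d (by simp [hA]) hcd.symm hc
    · exact iso_le d (by simp [hA]) a (by simp [hA]) had hda
  have hdisj_ab : Disjoint (S a) (S b) := by
    rw [Set.disjoint_left]; intro ω h1 h2
    exact h1.2 b (by simp) hab.symm h2.1
  have hdisj_ac : Disjoint (S a) (S c) := by
    rw [Set.disjoint_left]; intro ω h1 h2
    exact h1.2 c (by simp) hac.symm h2.1
  have hdisj_bc : Disjoint (S b) (S c) := by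
    rw [Set.disjoint_left]; intro ω h1 h2
    exact h1.2 c (by simp) hbc.symm h2.1
  have hsum : μ.real (S a) + μ.real (S b) + μ.real (S c) ≤ t := by
    have e1 : μ.real (S a ∪ S b) = μ.real (S a) + μ.real (S b) :=
      measureReal_union hdisj_ab MeasurableSet.of_discrete
    have e2 : μ.real ((S a ∪ S b) ∪ S c) = μ.real (S a ∪ S b) + μ.real (S c) :=
      measureReal_union (Disjoint.union_left hdisj_ac hdisj_bc) MeasurableSet.of_discrete
    have hsub : (S a ∪ S b) ∪ S c ⊆ N1 :=
      Set.union_subset (Set.union_subset (hSN a (by simp [hA])) (hSN b (by simp [hA]))) (hSN c (by simp [hA]))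
    have := measureReal_mono (μ := μ) hsub
    linarith
  linarith

/-- **Additive gluing for three relays with constant `4/3`**: for pairwise distinct `a,b,c,d`,
`μ(o ↔ {a,b,c}) − 4/3 · t ≤ μ(o ↔ d)` whenever `μ{x ↮ d} ≤ t` for `x = a,b,c`. [cite: KozmaNitzan2024, Conjecture (additive form), Lemma 2] -/
theorem additiveGluing_three_fourThirds (w : Sym2 (Fin n) → unitInterval) (o a b c d : Fin n) (t : ℝ)
    (hab : a ≠ b) (hac : a ≠ c) (had : a ≠ d) (hbc : b ≠ c) (hbd : b ≠ d) (hcd : c ≠ d)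
    (ha : (prodBernoulli w).real (openConn a d : Set (BondConfig (Fin n)))ᶜ ≤ t)
    (hb : (prodBernoulli w).real (openConn b d : Set (BondConfig (Fin n)))ᶜ ≤ t)
    (hc : (prodBernoulli w).real (openConn c d : Set (BondConfig (Fin n)))ᶜ ≤ t) :
    (prodBernoulli w).real ((openConn o a ∪ openConn o b ∪ openConn o c : Set (BondConfig (Fin n)))) - 4 / 3 * t ≤
      (prodBernoulli w).real (openConn o d : Set (BondConfig (Fin n))) := by
  set μ := prodBernoulli w with hμ
  have key := eventGluing_three_le_fourThirds w o a b c d t hab hac had hbc hbd hcd ha hb hc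
  have hsplit : μ.real ((openConn o a ∪ openConn o b ∪ openConn o c : Set (BondConfig (Fin n)))) ≤
      μ.real (openConn o d : Set (BondConfig (Fin n))) +
        μ.real ((openConn o d : Set (BondConfig (Fin n)))ᶜ ∩ (openConn o a ∪ openConn o b ∪ openConn o c)) := by
    calc μ.real ((openConn o a ∪ openConn o b ∪ openConn o c : Set (BondConfig (Fin n))))
        ≤ μ.real ((openConn o d : Set (BondConfig (Fin n))) ∪
            ((openConn o d : Set (BondConfig (Fin n)))ᶜ ∩ (openConn o a ∪ openConn o b ∪ openConn o c))) :=
          measureReal_mono fun ω hω => by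
            by_cases h : ω ∈ (openConn o d : Set (BondConfig (Fin n)))
            · exact Or.inl h
            · exact Or.inr ⟨h, hω⟩
      _ ≤ _ := measureReal_union_le _ _
  linarith

end Summit.CriticalPhenomena.PercolationContinuityZ3.Theorems

end
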